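import Summits.QuantumFields.BalabanUV.T4Continuum.Support.TermwiseHolderBinders
import Literature.MathematicalPhysics.QuantumFieldTheory.Balaban1983to89.B11Holder9

/-!
# TermwiseHolder (part 4/4) — the Hölder-exponent dictionary (`h_K = (L^{−β₀})^K`, `0 < β₀ ≤ 1`), the endpoint
`β₀ = 1` = generation 14, toys

HONEST FRAMING, PLACEMENT, ABSOLUTE RULE: see part 1/4 (`Support/TermwiseHolder`), whose module docstring governs
this file verbatim: FIXED FINITE four-torus, rung (B)+1, conditional; NOT infinite volume, NOT a mass gap, NOT the
Clay statement; the spine estimate NE7 is NOT PRINTED in [Balaban1984PropagatorsI]–[Balaban1989LargeFieldII] and NOT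
proved here; no sentence of print is quoted; every hypothesis is a NAMED binder.

Contents: §8 the dictionary between the profile of parts 1–3 and a Hölder exponent: for `1 < L`, `0 < β₀ ≤ 1` the
per-step rate `ϑ = L^{−β₀}` lies in `[L⁻¹, 1)` (`holderRate_window`; `B11Holder9.holderRate_lt_one` BY NAME), so
`h_K = ϑ^K` is an admissible `ℓ²` profile (`profile_holder`, from part 1's `profile_geometric`); a radius
`c·((L^K)⁻¹)^{2+β}` (real exponent — the SHAPE `B11Holder9.HolderClause` in which the sibling reads the printed
Hölder clauses, at `t = (L^K)⁻¹`) IS `c·((L^K)⁻¹)²·(L^{−β})^K` (`holderRadius_eq`, from `B11Holder9.rate_pow_eq` BY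
NAME; `radius_of_holderClause`); then the producer and the ledger theorem of part 3 READ AT `h_K = (L^{−β₀})^K`
(`interpolation_averaging_UN_of_locRegHolder`, `goodClause_summable_UN_of_locRegHolder`: the profile laws `hhK`,
`hh` DISCHARGED, the located input `hAreg`/`hBreg` typed with third radius `a₂ε₁L^{−2K}(L^{−β₀})^K`, `0 < β₀ ≤ 1`).
§9 the endpoint and toys: `dUP … (K ↦ L^{−K}) = T4TermwiseChainUN.dUN …` (`dUP_endpoint_eq_dUN`: `β₀ = 1` is
generation 14's chain), the hypothesis set of §6–§8 is satisfiable (`const_config_locRegProfile_U3`), `dUP` vanishes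
at `ε₁ = 0`.

Reading (orientation only, nothing asserted): generation 14's located input had the third radius at the Hölder
ENDPOINT `β₀ = 1` (`a₂ε₁L^{−3K}`), which the sibling `B11Holder9` (module docstring, cell GAPS C-B8-18, G-B11-F3a)
locates as delivered by nothing in the series, the derivable range being `0 ≤ β ≤ β₀ < 1`; the present chain accepts
every `0 < β₀ ≤ 1` at the cost of NOTHING in the rate bookkeeping except the oscillation share `∝ (L^{−2β₀})^K` of
`dUP` — still summable, which is all `cauchy_of_hybrid`-type bookkeeping consumes.  Whether the backgrounds of the
cell's T⁴ tower satisfy `hAreg`/`hBreg` so typed is the background-regularity INPUT of NE7 and is NOT asserted.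
-/

noncomputable section

open Finset MeasureTheory _root_.Filter _root_.Topology NormedSpace
open scoped BigOperators Matrix.Norms.L2Operator InnerProductSpace

namespace Summit.QuantumFields.BalabanUV.T4Continuum.TermwiseHolder

open Literature.MathematicalPhysics.QuantumFieldTheory.Balaban1983to89
open T4OutputRate T4RecentScale T4GoodClassBudget T4CauchySum T4Crossover T4TowerRateComposition T4TowerRateDischarge
open T4BoundaryCarrier (BFunctional atFl NE9Fl LipBackgroundFl NE5B)
open T4TermwiseBudget T4TermwiseDeviation T4TermwiseCurrency T4TermwiseBoundary T4TermwiseResidual T4TermwiseAction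
open T4TermwiseClassical T4TermwiseQuartic
open T4TermwiseInstantiate (cBCH cBCH_nonneg cSZ cSZ_nonneg)
open T4TermwiseOscillation (cOSC)
open B7Prop1Explicit B7Prop2Explicit T4TermwiseBCH T4TermwiseTorus T4TermwiseUN T4TermwiseChainUN
open TermwiseBackground B11Holder9

/-! ## §8 The Hölder-exponent dictionary -/

section Holder

/-- For `1 < L` and `0 < β ≤ 1` the per-step rate `L^{−β}` lies in the window `[L⁻¹, 1)` of part 1's
`profile_geometric` (the right end is `B11Holder9.holderRate_lt_one`). [folklore] -/
theorem holderRate_window {L β : ℝ} (hL : 1 < L) (hβ : 0 < β) (hβ1 : β ≤ 1) :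
    L⁻¹ ≤ L ^ (-β) ∧ L ^ (-β) < 1 := by
  refine ⟨?_, (holderRate_lt_one hL hβ).2⟩
  rw [← Real.rpow_neg_one L]
  exact Real.rpow_le_rpow_of_exponent_le hL.le (by linarith)

/-- `h_K = (L^{−β₀})^K`, `0 < β₀ ≤ 1`, is an admissible profile: `L^{−K} ≤ h_K ≤ 1` and `h ∈ ℓ²`. [folklore] -/
theorem profile_holder {L : ℕ} (hL : 2 ≤ L) {β₀ : ℝ} (hβ : 0 < β₀) (hβ1 : β₀ ≤ 1) :
    (∀ K : ℕ, ((L : ℝ) ^ K)⁻¹ ≤ ((L : ℝ) ^ (-β₀)) ^ K ∧ ((L : ℝ) ^ (-β₀)) ^ K ≤ 1) ∧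
      Summable (fun K : ℕ => (((L : ℝ) ^ (-β₀)) ^ K) ^ 2) := by
  have hL1 : (1 : ℝ) < L := by exact_mod_cast (lt_of_lt_of_le one_lt_two hL)
  have hw := holderRate_window hL1 hβ hβ1
  exact profile_geometric hL1 hw.1 hw.2

/-- RADIUS ALGEBRA: a radius `c·((L^K)⁻¹)^{2+β}` with a REAL exponent is `c·((L^K)⁻¹)²·(L^{−β})^K`
(`B11Holder9.rate_pow_eq`). [folklore] -/
theorem holderRadius_eq {L : ℝ} (hL : 0 < L) (c β : ℝ) (K : ℕ) :
    c * ((L ^ K)⁻¹) ^ (2 + β) = c * ((L ^ K)⁻¹) ^ 2 * (L ^ (-β)) ^ K := by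
  have ht : 0 < (L ^ K)⁻¹ := by positivity
  rw [Real.rpow_add ht, Real.rpow_two, rate_pow_eq hL β K, mul_assoc]

/-- A quantity obeying a clause of the SHAPE `B11Holder9.HolderClause hA β₀ C t` (`∀ β, 0 ≤ β ≤ β₀ → hA β < C·t^{2+β}`)
at the width `t = (L^K)⁻¹` obeys, at `β = β₀`, the profile-typed bound `hA β₀ < C·((L^K)⁻¹)²·(L^{−β₀})^K` — the type
of the third `LocReg` radius of part 3 with `h_K = (L^{−β₀})^K`.  (Dictionary only: which `hA`, `C` a consumer reads,
and that the backgrounds of a tower obey it, are NOT asserted.) [folklore] -/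
theorem radius_of_holderClause {hA : ℝ → ℝ} {β₀ C L : ℝ} (hL : 0 < L) (hβ : 0 ≤ β₀) (K : ℕ)
    (hc : HolderClause hA β₀ C ((L ^ K)⁻¹)) : hA β₀ < C * ((L ^ K)⁻¹) ^ 2 * (L ^ (-β₀)) ^ K := by
  rw [← holderRadius_eq hL C β₀ K]
  exact hc β₀ hβ le_rfl

variable {n : Type*} [Fintype n] [DecidableEq n] [Nonempty n]
variable {ι : Type} {σ : Type*} [DecidableEq σ] {l₀ : ℝ} {T : ℕ → Finset σ} {Bad : ℕ → ℝ → Finset σ} {Adm : Set ι}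

/-- **(U)(L) FOR `U(N)` WILSON TERMS FROM LOCAL REGULARITY WITH A HÖLDER EXPONENT `0 < β₀ ≤ 1`** — part 3's
`interpolation_averaging_UN_of_locRegProfile` READ AT the profile `h_K = (L^{−β₀})^K`, its profile laws `hhK`, `hh`
DISCHARGED by `profile_holder`.  REMAINING hypotheses, BY NAME: `hAU`/`hBU`, the LOCAL REGULARITY `hAreg`/`hBreg` with
radii `a₀ε₁L^{−K}`, `a₁ε₁L^{−2K}`, `a₂ε₁L^{−2K}·(L^{−β₀})^K` (`= a₂ε₁((L^K)⁻¹)^{2+β₀}`, `holderRadius_eq`; the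
background-regularity INPUT, NOT PRINTED as used here, NOT asserted), `0 < β₀ ≤ 1`, `0 ≤ ε₁ ≤ 1`, the smallness,
(repr) `hreprU`/`hreprL`, `2 ≤ M`, `2 ≤ L`, genuine planes.  OUTPUT: the per-term deviation bounds with majorants
`M⁴·dUP … (K ↦ (L^{−β₀})^K) K` (oscillation share `∝ (L^{−2β₀})^K`), `M⁴·dLN …`, nonnegative and SUMMABLE.
NOT NE7, NOT Clay. [folklore] -/
theorem interpolation_averaging_UN_of_locRegHolder {Y YA : Type*} {g : ℕ → ℝ → σ → ι → YA → ℝ}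
    {f₁ : ℕ → ℝ → σ → ι → Y → ℝ} {Q : ℕ → ℝ → σ → ι → Y → YA} {yA yB : ℕ → ℝ → σ → ι → Y}
    {xA : ℕ → ℝ → σ → ι → YA}
    (M L : ℕ) (hM : 2 ≤ M) (hL : 2 ≤ L) (planes : Finset (Fin 4 × Fin 4)) (hplanes : ∀ P ∈ planes, P.1 ≠ P.2)
    (VA VB : ℕ → ℝ → σ → ι → (B7Prop1Explicit.Site 4 → Fin 4 → (Matrix n n ℂ)ˣ))
    {a₀ a₁ a₂ ε₁ β₀ : ℝ}
    (ha₀ : 0 ≤ a₀) (ha₁ : 0 ≤ a₁) (ha₂ : 0 ≤ a₂) (hε₁1 : ε₁ ≤ 1)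
    (hsmall : 20480 * (L : ℝ) ^ 2 * (cReg a₀ a₁ * ε₁) ≤ 1)
    (hβ₀ : 0 < β₀) (hβ₀1 : β₀ ≤ 1)
    (hAU : ∀ K t, |t| ≤ l₀ → ∀ τ ∈ T K \ Bad K t, ∀ v ∈ Adm,
      (∀ x κ, VA K t τ v x κ ∈ unitaryUnits (Matrix n n ℂ)) ∧ IsPeriodic (M * L ^ K * L) (VA K t τ v))
    (hBU : ∀ K t, |t| ≤ l₀ → ∀ τ ∈ T K \ Bad K t, ∀ v ∈ Adm,
      (∀ x κ, VB K t τ v x κ ∈ unitaryUnits (Matrix n n ℂ)) ∧ IsPeriodic (M * L ^ K * L) (VB K t τ v))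
    (hAreg : ∀ K t, |t| ≤ l₀ → ∀ τ ∈ T K \ Bad K t, ∀ v ∈ Adm, ∀ z : B7Prop1Explicit.Site 4,
      LocReg (VA K t τ v) z 5 (a₀ * ε₁ * ((L : ℝ) ^ K)⁻¹) (a₁ * ε₁ * (((L : ℝ) ^ K)⁻¹) ^ 2)
        (a₂ * ε₁ * (((L : ℝ) ^ K)⁻¹) ^ 2 * ((L : ℝ) ^ (-β₀)) ^ K))
    (hBreg : ∀ K t, |t| ≤ l₀ → ∀ τ ∈ T K \ Bad K t, ∀ v ∈ Adm, ∀ z : B7Prop1Explicit.Site 4,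
      LocReg (VB K t τ v) z 5 (a₀ * ε₁ * ((L : ℝ) ^ K)⁻¹) (a₁ * ε₁ * (((L : ℝ) ^ K)⁻¹) ^ 2)
        (a₂ * ε₁ * (((L : ℝ) ^ K)⁻¹) ^ 2 * ((L : ℝ) ^ (-β₀)) ^ K))
    (hreprU : ∀ K t, |t| ≤ l₀ → ∀ τ ∈ T K \ Bad K t, ∀ v ∈ Adm,
      f₁ K t τ v (yA K t τ v) = ∑ x ∈ pbox planes (M * L ^ K * L), eN (phiU (VA K t τ v) x) ∧
        g K t τ v (xA K t τ v) = ∑ y ∈ pbox planes (M * L ^ K), eN (psiU L (VA K t τ v) y))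
    (hreprL : ∀ K t, |t| ≤ l₀ → ∀ τ ∈ T K \ Bad K t, ∀ v ∈ Adm,
      f₁ K t τ v (yB K t τ v) = ∑ x ∈ pbox planes (M * L ^ K * L), eN (phiU (VB K t τ v) x) ∧
        g K t τ v (Q K t τ v (yB K t τ v)) = ∑ y ∈ pbox planes (M * L ^ K), eN (psiU L (VB K t τ v) y))
    (hε₁ : 0 ≤ ε₁) :
    (∀ K t, |t| ≤ l₀ → ∀ τ ∈ T K \ Bad K t, ∀ v ∈ Adm,
      f₁ K t τ v (yA K t τ v) - g K t τ v (xA K t τ v)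
        ≤ (M : ℝ) ^ 4 * dUP (Fintype.card n) L planes.card (cReg a₀ a₁) (cOscReg L a₀ a₁ a₂) ε₁ (fun K => ((L : ℝ) ^ (-β₀)) ^ K) K) ∧
    (∀ K t, |t| ≤ l₀ → ∀ τ ∈ T K \ Bad K t, ∀ v ∈ Adm,
      g K t τ v (Q K t τ v (yB K t τ v)) - f₁ K t τ v (yB K t τ v)
        ≤ (M : ℝ) ^ 4 * dLN (Fintype.card n) L planes.card (cReg a₀ a₁) ε₁ K) ∧
    (∀ K, 0 ≤ dUP (Fintype.card n) L planes.card (cReg a₀ a₁) (cOscReg L a₀ a₁ a₂) ε₁ (fun K => ((L : ℝ) ^ (-β₀)) ^ K) K) ∧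
    (∀ K, 0 ≤ dLN (Fintype.card n) L planes.card (cReg a₀ a₁) ε₁ K) ∧
    Summable (dUP (Fintype.card n) L planes.card (cReg a₀ a₁) (cOscReg L a₀ a₁ a₂) ε₁
      (fun K => ((L : ℝ) ^ (-β₀)) ^ K)) ∧
    Summable (dLN (Fintype.card n) L planes.card (cReg a₀ a₁) ε₁) := by
  obtain ⟨hp, hs⟩ := profile_holder hL hβ₀ hβ₀1
  exact interpolation_averaging_UN_of_locRegProfile (g := g) (f₁ := f₁) (Q := Q) (yA := yA) (yB := yB) (xA := xA)
    (h := fun K => ((L : ℝ) ^ (-β₀)) ^ K) M L hM hL planes hplanes VA VB ha₀ ha₁ ha₂ hε₁1 hsmall (fun K => (hp K).1)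
    hs hAU hBU hAreg hBreg hreprU hreprL hε₁

end Holder

/-! ## §8′ The ledger theorem read at a Hölder exponent -/

section Ledger

variable {n : Type*} [Fintype n] [DecidableEq n] [Nonempty n]
variable {C : T4BoundaryCarrier.Carriers} {ι : Type} [MeasurableSpace ι] {σ : Type*} [DecidableEq σ] {l₀ vol : ℝ}
  {T : ℕ → Finset σ} {Bad : ℕ → ℝ → Finset σ} {A B : ℕ → ℝ → σ → ℝ} {μ : ℕ → ℝ → σ → Measure ι}
  {fac bfac rfac : ℕ → ℝ → σ → Finset C.Dom} {Adm : Set ι} {EA : Functional C.toCarriers C.BgA}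
  {EB : Functional C.toCarriers C.BgB} {BA : BFunctional C C.BgA} {BB : BFunctional C C.BgB}
  {RA : Functional C.toCarriers C.BgA} {RB : Functional C.toCarriers C.BgB}
  {κ θ' Cr EB₀ CrR R₁ b β' w₀ : ℝ} {κ₀ : ℕ} {gA gB : ℕ → ℕ → ℝ} {gfA gfB : ℕ → ℝ} {gsA gsB : ℕ → ℕ → ℝ}
  {uA : ℕ → ι → C.BgA} {uB : ℕ → ι → C.BgB} {oneA : C.BgA} {oneB : C.BgB}
  {pend : ℕ → ℝ → σ → ι → C.Fl} {nA nB aA aB wA wB γA γB : ℕ → ℝ → σ → ι → ℝ} {qA qB : ℕ → ℝ}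
  {κ₁ S : ℕ → ℝ → σ → ℕ → ℝ} {cW RW : ℕ → ℝ → σ → ℝ} {rw sw rγ zA zB c₀ : ℕ → ℝ} {Cw E a Λ Cl : ℝ}

/-- **THE GOOD-CLASS HALF WITH `Summable δ⁗` FOR G = U(N) WILSON TERMS, BACKGROUND BINDERS FROM LOCAL REGULARITY
WITH A HÖLDER EXPONENT `0 < β₀ ≤ 1`: part 3's `goodClause_summable_UN_of_locRegProfile` READ AT `h_K = (L^{−β₀})^K`,
the profile laws DISCHARGED by `profile_holder`.**  Every other ledger binder is carried BY NAME and VERBATIM (none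
discharged) — the flow window (0.31) of [Balaban1987RG1] sits in `h031A`/`h031B`; (repr) `hreprU hreprL`, `hAU hBU`,
the LOCAL REGULARITY `hAreg hBreg` with radii `a₀ε₁L^{−K}`, `a₁ε₁L^{−2K}`, `a₂ε₁L^{−2K}(L^{−β₀})^K` (the INPUT
replacing (44), (44∇) and both decay laws; NOT PRINTED as used here), `0 < β₀ ≤ 1`, `0 ≤ ε₁ ≤ 1`, the smallness
`20480·L²·cReg·ε₁ ≤ 1`, `2 ≤ M`, `2 ≤ L`, genuine planes and `M⁴ ≤ vol` are hypotheses.  OUTPUT: the good clause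
with `δ⁗` whose action-kind share is `w₀·(dUP N L #planes cReg cOscReg ε₁ (K ↦ (L^{−β₀})^K) K + dLN …)`, and
`Summable δ⁗`.  `β₀ = 1` is generation 14's `TermwiseBackground.goodClause_summable_UN_of_locReg` up to
`dUP_endpoint_eq_dUN`.  No print is quoted; nothing printed is asserted; NOT NE7, NOT Clay. [folklore] -/
theorem goodClause_summable_UN_of_locRegHolder {Y YA : Type*} {Sfib : ℕ → ℝ → σ → ι → Set Y}
    {SfibA : ℕ → ℝ → σ → ι → Set YA} {g : ℕ → ℝ → σ → ι → YA → ℝ} {f₁ : ℕ → ℝ → σ → ι → Y → ℝ}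
    {Q : ℕ → ℝ → σ → ι → Y → YA} {yA yB : ℕ → ℝ → σ → ι → Y} {xA : ℕ → ℝ → σ → ι → YA}
    (M L : ℕ) (hMtwo : 2 ≤ M) (hLtwo : 2 ≤ L) (planes : Finset (Fin 4 × Fin 4))
    (hplanes : ∀ P ∈ planes, P.1 ≠ P.2)
    (VA VB : ℕ → ℝ → σ → ι → (B7Prop1Explicit.Site 4 → Fin 4 → (Matrix n n ℂ)ˣ))
    {a₀ a₁ a₂ ε₁ β₀ : ℝ}
    (hUR : ∀ K, URateUpTo K EA EB (gA K) (gB K) (uA K) (uB K) Adm Cr θ' κ) (hCr : 0 ≤ Cr)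
    (hθ'0 : 0 < θ') (hθ'1 : θ' < 1) (hθ'Λ : θ' ≤ Λ) (hΛ1 : 1 ≤ Λ) (hCl : 0 ≤ Cl)
    (hURB : ∀ b ∈ C.admFl, ∀ K, URateUpTo K (atFl BA b) (atFl BB b) (gA K) (gB K) (uA K) (uB K) Adm EB₀ θ' κ)
    (hEB₀ : 0 ≤ EB₀)
    (hURR : ∀ K, URateUpTo K RA RB (gA K) (gB K) (uA K) (uB K) Adm CrR θ' κ) (hCrR : 0 ≤ CrR)
    (hfmtA : ∀ K t τ, A K t τ = ∫ v, (∏ X ∈ fac K t τ,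
      Real.exp (EA (gA K) (uA K v) X - EA (gA K) oneA X)) *
        ((∏ X ∈ bfac K t τ, Real.exp (BA (gA K) (uA K v) (pend K t τ v) X)) * nA K t τ v * qA K *
          ((∏ X ∈ rfac K t τ, Real.exp (RA (gA K) (uA K v) X - RA (gA K) oneA X)) * (Real.exp (-aA K t τ v) * wA K t τ v)))
          ∂(μ K t τ))
    (hfmtB : ∀ K t τ, B K t τ = ∫ v, (∏ X ∈ fac K t τ,
      Real.exp (EB (gB K) (uB K v) X - EB (gB K) oneB X)) *
        ((∏ X ∈ bfac K t τ, Real.exp (BB (gB K) (uB K v) (pend K t τ v) X)) * nB K t τ v * qB K *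
          ((∏ X ∈ rfac K t τ, Real.exp (RB (gB K) (uB K v) X - RB (gB K) oneB X)) * (Real.exp (-aB K t τ v) * wB K t τ v)))
          ∂(μ K t τ))
    (hint : ∀ K t, |t| ≤ l₀ → ∀ τ ∈ T K \ Bad K t,
      Integrable (fun v => (∏ X ∈ fac K t τ, Real.exp (EA (gA K) (uA K v) X - EA (gA K) oneA X)) *
        ((∏ X ∈ bfac K t τ, Real.exp (BA (gA K) (uA K v) (pend K t τ v) X)) * nA K t τ v * qA K *
          ((∏ X ∈ rfac K t τ, Real.exp (RA (gA K) (uA K v) X - RA (gA K) oneA X)) * (Real.exp (-aA K t τ v) * wA K t τ v))))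
          (μ K t τ) ∧
      Integrable (fun v => (∏ X ∈ fac K t τ, Real.exp (EB (gB K) (uB K v) X - EB (gB K) oneB X)) *
        ((∏ X ∈ bfac K t τ, Real.exp (BB (gB K) (uB K v) (pend K t τ v) X)) * nB K t τ v * qB K *
          ((∏ X ∈ rfac K t τ, Real.exp (RB (gB K) (uB K v) X - RB (gB K) oneB X)) * (Real.exp (-aB K t τ v) * wB K t τ v))))
          (μ K t τ))
    (hsc : ∀ K t, |t| ≤ l₀ → ∀ τ ∈ T K \ Bad K t, ∀ X ∈ fac K t τ, C.scale X ≤ K)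
    (hoff : ∀ K t, |t| ≤ l₀ → ∀ τ ∈ T K \ Bad K t, ∀ v, v ∉ Adm →
      (∏ X ∈ fac K t τ, Real.exp (EA (gA K) (uA K v) X - EA (gA K) oneA X)) *
        ((∏ X ∈ bfac K t τ, Real.exp (BA (gA K) (uA K v) (pend K t τ v) X)) * nA K t τ v * qA K *
          ((∏ X ∈ rfac K t τ, Real.exp (RA (gA K) (uA K v) X - RA (gA K) oneA X)) * (Real.exp (-aA K t τ v) * wA K t τ v)))
          = 0 ∧
      (∏ X ∈ fac K t τ, Real.exp (EB (gB K) (uB K v) X - EB (gB K) oneB X)) *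
        ((∏ X ∈ bfac K t τ, Real.exp (BB (gB K) (uB K v) (pend K t τ v) X)) * nB K t τ v * qB K *
          ((∏ X ∈ rfac K t τ, Real.exp (RB (gB K) (uB K v) X - RB (gB K) oneB X)) * (Real.exp (-aB K t τ v) * wB K t τ v)))
          = 0)
    (hS : ∀ K t, |t| ≤ l₀ → ∀ τ ∈ T K \ Bad K t, ∀ v ∈ Adm, ∀ j ≤ K,
      |(∑ X ∈ fac K t τ with C.scale X = j,
          (Real.log (Real.exp (EB (gB K) (uB K v) X - EB (gB K) oneB X))
            - Real.log (Real.exp (EA (gA K) (uA K v) X - EA (gA K) oneA X)))) - κ₁ K t τ j| ≤ S K t τ j)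
    (hM : ∀ K t, |t| ≤ l₀ → ∀ τ ∈ T K \ Bad K t,
      Multiplicity (fac K t τ) C.scale (fun X => Real.exp (-(κ * C.d X))) Cw vol Λ K)
    (hwit : ∀ K, ∃ v₁ ∈ Adm, uA K v₁ = oneA ∧ uB K v₁ = oneB)
    (hvol : 0 ≤ vol) (hE : 0 ≤ E) (ha0 : 0 < a) (ha1 : a < 1)
    (hSle : ∀ K t, |t| ≤ l₀ → ∀ τ ∈ T K \ Bad K t, ∀ j ≤ K, S K t τ j ≤ vol * (E * a ^ (K - j)))
    (hpend : ∀ K t, |t| ≤ l₀ → ∀ τ ∈ T K \ Bad K t, ∀ v ∈ Adm, pend K t τ v ∈ C.admFl)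
    (hBwin : ∀ K t, |t| ≤ l₀ → ∀ τ ∈ T K \ Bad K t, RecentOnly (bfac K t τ) C.scale (jlogOf Cl K) K)
    (hMB : ∀ K t, |t| ≤ l₀ → ∀ τ ∈ T K \ Bad K t,
      Multiplicity (bfac K t τ) C.scale (fun X => Real.exp (-(κ * C.d X))) Cw vol Λ K)
    (hnpos : ∀ K t, |t| ≤ l₀ → ∀ τ ∈ T K \ Bad K t, ∀ v ∈ Adm, 0 < nA K t τ v ∧ 0 < nB K t τ v)
    (hzA : ∀ K t, |t| ≤ l₀ → ∀ τ ∈ T K \ Bad K t, ∀ v ∈ Adm, |Real.log (nA K t τ v)| ≤ vol * zA K)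
    (hzB : ∀ K t, |t| ≤ l₀ → ∀ τ ∈ T K \ Bad K t, ∀ v ∈ Adm, |Real.log (nB K t τ v)| ≤ vol * zB K)
    (hzAs : Summable zA) (hzBs : Summable zB)
    (hq : ∀ K, 0 < qA K ∧ 0 < qB K)
    -- the 𝐑-kind: scales, multiplicity, one-run slice sizes, the flow window of both coupling tables
    (hrsc : ∀ K t, |t| ≤ l₀ → ∀ τ ∈ T K \ Bad K t, ∀ X ∈ rfac K t τ, C.scale X ≤ K)
    (hMR : ∀ K t, |t| ≤ l₀ → ∀ τ ∈ T K \ Bad K t,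
      Multiplicity (rfac K t τ) C.scale (fun X => Real.exp (-(κ * C.d X))) Cw vol Λ K)
    (hRSA : ∀ K t, |t| ≤ l₀ → ∀ τ ∈ T K \ Bad K t, ∀ v ∈ Adm, ∀ j ≤ K,
      |∑ X ∈ rfac K t τ with C.scale X = j, (RA (gA K) (uA K v) X - RA (gA K) oneA X)| ≤ vol * (R₁ * gsA K j ^ κ₀))
    (hRSB : ∀ K t, |t| ≤ l₀ → ∀ τ ∈ T K \ Bad K t, ∀ v ∈ Adm, ∀ j ≤ K,
      |∑ X ∈ rfac K t τ with C.scale X = j, (RB (gB K) (uB K v) X - RB (gB K) oneB X)| ≤ vol * (R₁ * gsB K j ^ κ₀))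
    (hb : 0 < b) (h031A : ∀ K, Step.Discrete031 b β' K (gfA K) (gsA K))
    (h031B : ∀ K, Step.Discrete031 b β' K (gfB K) (gsB K)) (hgsA : ∀ K k, k ≤ K → 0 ≤ gsA K k)
    (hgsB : ∀ K k, k ≤ K → 0 ≤ gsB K k) (hR₁ : 0 ≤ R₁) (hκ₀ : 4 < κ₀)
    -- the ACTION kind from ONE CLASSICAL STEP: (min-A) (Q) (lift) (min-B) (act) (U) (L) (γ)
    (hminA : ∀ K t, |t| ≤ l₀ → ∀ τ ∈ T K \ Bad K t, ∀ v ∈ Adm, IsMinOn (g K t τ v) (SfibA K t τ v) (xA K t τ v))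
    (hQ : ∀ K t, |t| ≤ l₀ → ∀ τ ∈ T K \ Bad K t, ∀ v ∈ Adm, Set.MapsTo (Q K t τ v) (Sfib K t τ v) (SfibA K t τ v))
    (hlift : ∀ K t, |t| ≤ l₀ → ∀ τ ∈ T K \ Bad K t, ∀ v ∈ Adm,
      yA K t τ v ∈ Sfib K t τ v ∧ Q K t τ v (yA K t τ v) = xA K t τ v)
    (hminB : ∀ K t, |t| ≤ l₀ → ∀ τ ∈ T K \ Bad K t, ∀ v ∈ Adm,
      yB K t τ v ∈ Sfib K t τ v ∧ IsMinOn (f₁ K t τ v) (Sfib K t τ v) (yB K t τ v))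
    (hact : ∀ K t, |t| ≤ l₀ → ∀ τ ∈ T K \ Bad K t, ∀ v ∈ Adm,
      aA K t τ v = w₀ * g K t τ v (xA K t τ v) + γA K t τ v ∧
        aB K t τ v = w₀ * f₁ K t τ v (yB K t τ v) + γB K t τ v)
    (hw₀ : 0 ≤ w₀)
    -- (U)(L) PRODUCED for G = U(N) Wilson terms (`interpolation_averaging_UN_of_locRegHolder`): (repr) `hreprU hreprL`,
    -- unitarity/periodicity `hAU hBU`, LOCAL REGULARITY with second-difference radius `a₂ε₁L^{−2K}(L^{−β₀})^K`,
    -- `0 < β₀ ≤ 1` (`hAreg hBreg hβ₀ hβ₀1`; (44), (44∇), the smallness and both decay laws DERIVED), `ε₁ ≤ 1`, the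
    -- smallness `20480·L²·cReg·ε₁ ≤ 1`, `hε₁`, and `M⁴ ≤ vol`
    (ha₀ : 0 ≤ a₀) (ha₁ : 0 ≤ a₁) (ha₂ : 0 ≤ a₂) (hε₁1 : ε₁ ≤ 1)
    (hsmall : 20480 * (L : ℝ) ^ 2 * (cReg a₀ a₁ * ε₁) ≤ 1)
    (hβ₀ : 0 < β₀) (hβ₀1 : β₀ ≤ 1)
    (hAU : ∀ K t, |t| ≤ l₀ → ∀ τ ∈ T K \ Bad K t, ∀ v ∈ Adm,
      (∀ x κ, VA K t τ v x κ ∈ unitaryUnits (Matrix n n ℂ)) ∧ IsPeriodic (M * L ^ K * L) (VA K t τ v))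
    (hBU : ∀ K t, |t| ≤ l₀ → ∀ τ ∈ T K \ Bad K t, ∀ v ∈ Adm,
      (∀ x κ, VB K t τ v x κ ∈ unitaryUnits (Matrix n n ℂ)) ∧ IsPeriodic (M * L ^ K * L) (VB K t τ v))
    (hAreg : ∀ K t, |t| ≤ l₀ → ∀ τ ∈ T K \ Bad K t, ∀ v ∈ Adm, ∀ z : B7Prop1Explicit.Site 4,
      LocReg (VA K t τ v) z 5 (a₀ * ε₁ * ((L : ℝ) ^ K)⁻¹) (a₁ * ε₁ * (((L : ℝ) ^ K)⁻¹) ^ 2)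
        (a₂ * ε₁ * (((L : ℝ) ^ K)⁻¹) ^ 2 * ((L : ℝ) ^ (-β₀)) ^ K))
    (hBreg : ∀ K t, |t| ≤ l₀ → ∀ τ ∈ T K \ Bad K t, ∀ v ∈ Adm, ∀ z : B7Prop1Explicit.Site 4,
      LocReg (VB K t τ v) z 5 (a₀ * ε₁ * ((L : ℝ) ^ K)⁻¹) (a₁ * ε₁ * (((L : ℝ) ^ K)⁻¹) ^ 2)
        (a₂ * ε₁ * (((L : ℝ) ^ K)⁻¹) ^ 2 * ((L : ℝ) ^ (-β₀)) ^ K))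
    (hreprU : ∀ K t, |t| ≤ l₀ → ∀ τ ∈ T K \ Bad K t, ∀ v ∈ Adm,
      f₁ K t τ v (yA K t τ v) = ∑ x ∈ pbox planes (M * L ^ K * L), eN (phiU (VA K t τ v) x) ∧
        g K t τ v (xA K t τ v) = ∑ y ∈ pbox planes (M * L ^ K), eN (psiU L (VA K t τ v) y))
    (hreprL : ∀ K t, |t| ≤ l₀ → ∀ τ ∈ T K \ Bad K t, ∀ v ∈ Adm,
      f₁ K t τ v (yB K t τ v) = ∑ x ∈ pbox planes (M * L ^ K * L), eN (phiU (VB K t τ v) x) ∧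
        g K t τ v (Q K t τ v (yB K t τ v)) = ∑ y ∈ pbox planes (M * L ^ K), eN (psiU L (VB K t τ v) y))
    (hε₁ : 0 ≤ ε₁) (hMvol : ((M : ℝ)) ^ 4 ≤ vol)
    (hγ : ∀ K t, |t| ≤ l₀ → ∀ τ ∈ T K \ Bad K t, ∀ v ∈ Adm, |γB K t τ v - γA K t τ v| ≤ vol * rγ K)
    (hrγ : Summable rγ)
    -- the residual kind after generation 8: (R-w) radii about a centre `cW`, (W-w) the WITNESS log-ratio centred
    (hwpos : ∀ K t, |t| ≤ l₀ → ∀ τ ∈ T K \ Bad K t, ∀ v ∈ Adm, 0 < wA K t τ v ∧ 0 < wB K t τ v)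
    (hRw : ∀ K t, |t| ≤ l₀ → ∀ τ ∈ T K \ Bad K t, ∀ v ∈ Adm,
      |Real.log (wB K t τ v) - Real.log (wA K t τ v) - cW K t τ| ≤ RW K t τ)
    (hRRw : ∀ K t, |t| ≤ l₀ → ∀ τ ∈ T K \ Bad K t, RW K t τ ≤ vol * rw K) (hrw : Summable rw)
    (hWw : ∀ K t, |t| ≤ l₀ → ∀ τ ∈ T K \ Bad K t, ∀ v ∈ Adm, uA K v = oneA → uB K v = oneB →
      |Real.log (wB K t τ v) - Real.log (wA K t τ v) - c₀ K| ≤ vol * sw K)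
    (hsw : Summable sw) :
    GoodClause l₀ vol T A B Bad
        (fun K => (max Cw 1 * ((E + Cr) * ∑ x ∈ antidiagonal K, min (a ^ x.2) (θ' ^ x.1 * Λ ^ x.2))
            + (EB₀ * Cw * windowSum θ' Λ (jlogOf Cl K) K + (zA K + zB K)
              + (max (2 * Cw) 1 * ((∑ p ∈ antidiagonal K, min (R₁ * gsA K p.1 ^ κ₀) (CrR * θ' ^ p.1 * Λ ^ p.2))
                  + ∑ p ∈ antidiagonal K, min (R₁ * gsB K p.1 ^ κ₀) (CrR * θ' ^ p.1 * Λ ^ p.2))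
                + (w₀ * (dUP (Fintype.card n) L planes.card (cReg a₀ a₁) (cOscReg L a₀ a₁ a₂) ε₁ (fun K => ((L : ℝ) ^ (-β₀)) ^ K) K + dLN (Fintype.card n) L planes.card (cReg a₀ a₁) ε₁ K)
                  + rγ K + rw K))))
          + (max Cw 1 * ((E + Cr) * ∑ x ∈ antidiagonal K, min (a ^ x.2) (θ' ^ x.1 * Λ ^ x.2)) + (rw K + sw K))) ∧
      Summable (fun K => (max Cw 1 * ((E + Cr) * ∑ x ∈ antidiagonal K, min (a ^ x.2) (θ' ^ x.1 * Λ ^ x.2))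
            + (EB₀ * Cw * windowSum θ' Λ (jlogOf Cl K) K + (zA K + zB K)
              + (max (2 * Cw) 1 * ((∑ p ∈ antidiagonal K, min (R₁ * gsA K p.1 ^ κ₀) (CrR * θ' ^ p.1 * Λ ^ p.2))
                  + ∑ p ∈ antidiagonal K, min (R₁ * gsB K p.1 ^ κ₀) (CrR * θ' ^ p.1 * Λ ^ p.2))
                + (w₀ * (dUP (Fintype.card n) L planes.card (cReg a₀ a₁) (cOscReg L a₀ a₁ a₂) ε₁ (fun K => ((L : ℝ) ^ (-β₀)) ^ K) K + dLN (Fintype.card n) L planes.card (cReg a₀ a₁) ε₁ K)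
                  + rγ K + rw K))))
          + (max Cw 1 * ((E + Cr) * ∑ x ∈ antidiagonal K, min (a ^ x.2) (θ' ^ x.1 * Λ ^ x.2)) + (rw K + sw K))) := by
  obtain ⟨hp, hs⟩ := profile_holder hLtwo hβ₀ hβ₀1
  exact goodClause_summable_UN_of_locRegProfile (Sfib := Sfib) (SfibA := SfibA) (g := g) (f₁ := f₁) (Q := Q)
    (yA := yA) (yB := yB) (xA := xA) (h := fun K => ((L : ℝ) ^ (-β₀)) ^ K) M L hMtwo hLtwo planes hplanes VA VB hUR
    hCr hθ'0 hθ'1 hθ'Λ hΛ1 hCl hURB hEB₀ hURR hCrR hfmtA hfmtB hint hsc hoff hS hM hwit hvol hE ha0 ha1 hSle hpend hBwin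
    hMB hnpos hzA hzB hzAs hzBs hq hrsc hMR hRSA hRSB hb h031A h031B hgsA hgsB hR₁ hκ₀ hminA hQ hlift hminB hact hw₀ ha₀
    ha₁ ha₂ hε₁1 hsmall (fun K => (hp K).1) hs hAU hBU hAreg hBreg hreprU hreprL hε₁ hMvol hγ hrγ hwpos hRw hRRw hrw
    hWw hsw

end Ledger

/-! ## §9 The endpoint `β₀ = 1` and toys (non-vacuity; the constants at trivial points) -/

section Toy

/-- THE ENDPOINT: at the profile `h_K = L^{−K}` (`β₀ = 1`) the (U)-majorant of part 2 IS generation 13's `dUN`, so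
parts 2–3 read at that profile are generation 13's/14's chain. [folklore] -/
theorem dUP_endpoint_eq_dUN (N L n : ℕ) (cα cα₁ ε₁ : ℝ) (K : ℕ) :
    dUP N L n cα cα₁ ε₁ (fun K => ((L : ℝ) ^ K)⁻¹) K = dUN N L n cα cα₁ ε₁ K := by
  rw [dUP_def, dUN_def, ← inv_pow, ← pow_mul, mul_comm K 2, pow_mul, inv_pow]
  ring

/-- The rate `L^{−β₀}` at `β₀ = 1` is `L⁻¹`: the endpoint profile of `profile_holder` is `K ↦ L^{−K}`. [folklore] -/
theorem holderProfile_one (L K : ℕ) : (((L : ℝ)) ^ (-(1 : ℝ))) ^ K = ((L : ℝ) ^ K)⁻¹ := by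
  rw [Real.rpow_neg_one, inv_pow]

/-- The constant `U(3)` configuration satisfies the hypotheses `hAU`/`hAreg` of §6–§8 at every scale with radii
`a₀ = a₁ = a₂ = 0` and ANY profile, the smallness holds, and the endpoint profile obeys `hhK`/`hh` (`L = 2`): the
hypothesis set of parts 3–4 is satisfiable. [folklore] -/
theorem const_config_locRegProfile_U3 (Np : ℕ) (z : B7Prop1Explicit.Site 4) (K : ℕ) (ε₁ : ℝ) (h : ℕ → ℝ) :
    (∀ (x : B7Prop1Explicit.Site 4) (κ : Fin 4),
        (fun (_ : B7Prop1Explicit.Site 4) (_ : Fin 4) => (1 : (Matrix (Fin 3) (Fin 3) ℂ)ˣ)) x κ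
          ∈ unitaryUnits (Matrix (Fin 3) (Fin 3) ℂ)) ∧
      IsPeriodic Np (fun (_ : B7Prop1Explicit.Site 4) (_ : Fin 4) => (1 : (Matrix (Fin 3) (Fin 3) ℂ)ˣ)) ∧
      LocReg (fun (_ : B7Prop1Explicit.Site 4) (_ : Fin 4) => (1 : (Matrix (Fin 3) (Fin 3) ℂ)ˣ)) z 5
        (0 * ε₁ * (((2 : ℕ) : ℝ) ^ K)⁻¹) (0 * ε₁ * ((((2 : ℕ) : ℝ) ^ K)⁻¹) ^ 2)
        (0 * ε₁ * ((((2 : ℕ) : ℝ) ^ K)⁻¹) ^ 2 * h K) ∧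
      20480 * ((2 : ℕ) : ℝ) ^ 2 * (cReg 0 0 * ε₁) ≤ 1 ∧
      (∀ K : ℕ, (((2 : ℕ) : ℝ) ^ K)⁻¹ ≤ (((2 : ℕ) : ℝ) ^ K)⁻¹) ∧
      Summable (fun K : ℕ => ((((2 : ℕ) : ℝ) ^ K)⁻¹) ^ 2) := by
  refine ⟨fun _ _ => Subgroup.one_mem _, fun _ _ => rfl, ?_, by simp [cReg], fun K => le_rfl,
    (profile_endpoint (L := ((2 : ℕ) : ℝ)) (by norm_num)).2⟩
  simpa using locReg_one (𝔸 := Matrix (Fin 3) (Fin 3) ℂ) z 5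

/-- At `ε₁ = 0` the profile majorant vanishes for every profile (generation 13's `dUN_dLN_zero` is the endpoint).
[folklore] -/
theorem dUP_zero (N L n : ℕ) (cα cα₁ : ℝ) (h : ℕ → ℝ) (K : ℕ) : dUP N L n cα cα₁ 0 h K = 0 := by
  simp [dUP]

/-- Numeric instance of the window of §8: `L = 2`, `β₀ = 1/2`: `2⁻¹ ≤ 2^{−1/2} < 1`. [folklore] -/
example : (2 : ℝ)⁻¹ ≤ (2 : ℝ) ^ (-(1 / 2 : ℝ)) ∧ (2 : ℝ) ^ (-(1 / 2 : ℝ)) < 1 :=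
  holderRate_window (by norm_num) (by norm_num) (by norm_num)

end Toy

end Summit.QuantumFields.BalabanUV.T4Continuum.TermwiseHolder
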